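import Summits.AtomisticToContinuum.FouriersLaw.Theses.EmbeddedDrudeMourre
import Summits.AtomisticToContinuum.FouriersLaw.Theses.KineticCorner
import Summits.AtomisticToContinuum.FouriersLaw.Theorems.KineticCornerGoodFamilyExists
import Summits.AtomisticToContinuum.FouriersLaw.Theorems.EmbeddedDrudeMourreDrudeDissolutionStubTargetGlue
import HarnessLib

/-!
# `MourreDissolution` from the three open leaves of route `KineticCorner` (stmt-AtomisticToContinuum-12594)

Crux `EmbeddedDrudeMourre.MourreDissolution` (stmt-AtomisticToContinuum-12594, line
`separable-vertex-faddeev-pair-sector`, continuation lead c4). The crux is implied by the target of the sibling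
regime route, `KineticCorner.KineticCornerGreenKubo` (stmt-3429), through the landed bridge
`Theorems.MourreDissolution.mourreDissolution_of_kineticCornerGreenKubo` (lead c2, p121356); that target is in turn
assembled from its leaves by the CLOSED glue `KineticCorner.TargetGlue` (stmt-3436,
`Theorems.DrudeDissolution.LineSketch.stub_targetGlue`) fed with the CLOSED existence item `KineticCorner.GoodFamilyExists`
(stmt-3434, `Theorems.KineticCorner.goodFamilyExists_proof`). Composing the three records, at leaf level and by name, the
exact set of OPEN statements modulo which this crux is closed today:

* `KineticCorner.PostKineticTail` (stmt-AtomisticToContinuum-3430, open — the non-perturbative tail bound),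
* `KineticCorner.KineticLimit` (stmt-AtomisticToContinuum-3431, open — the wave-kinetic limit on every kinetic window),
* `KineticCorner.StationaryCorrelationBound` (stmt-AtomisticToContinuum-3435, open, in flight — `|C_T(t)| ≤ B T²`).

CONDITIONAL result (three registered route items as hypotheses); it closes nothing by itself and is landed
`--supports stmt-AtomisticToContinuum-12594` as the crux's dependency certificate (the line's own open stubs
`stub_oddSectorMourreEstimate` / `stub_fgrPositivity` are not used: the first is logically stronger than the crux,
the second follows from the same three leaves).
-/

namespace Summit.AtomisticToContinuum.FouriersLaw.Theorems.MourreDissolution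

/-- **`MourreDissolution ⇐ PostKineticTail ∧ KineticLimit ∧ StationaryCorrelationBound`** (crux
stmt-AtomisticToContinuum-12594 from the three open leaves stmt-3430, stmt-3431, stmt-3435 of route `KineticCorner`):
`TargetGlue` (stmt-3436, closed) with `GoodFamilyExists` (stmt-3434, closed) gives `KineticCornerGreenKubo` (stmt-3429), and the
bridge `mourreDissolution_of_kineticCornerGreenKubo` gives the crux. CONDITIONAL on the three hypotheses. [folklore] -/
theorem mourreDissolution_of_kineticInputs :
    Summit.AtomisticToContinuum.FouriersLaw.Theses.KineticCorner.PostKineticTail →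
      Summit.AtomisticToContinuum.FouriersLaw.Theses.KineticCorner.KineticLimit →
        Summit.AtomisticToContinuum.FouriersLaw.Theses.KineticCorner.StationaryCorrelationBound →
          Summit.AtomisticToContinuum.FouriersLaw.Theses.EmbeddedDrudeMourre.MourreDissolution :=
  fun hPKT hKL hSCB =>
    mourreDissolution_of_kineticCornerGreenKubo
      (DrudeDissolution.LineSketch.stub_targetGlue hPKT hKL hSCB KineticCorner.goodFamilyExists_proof)

end Summit.AtomisticToContinuum.FouriersLaw.Theorems.MourreDissolution
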